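import Summits.QuantumAdvantage.QuantumAdvantage.Theorems.LinnikCubicClassGroupsDegreeOnePrimesEscapePerCharacterDeficitZeroSum
import Literature.NumberTheory.LFunctions.DedekindZetaExplicitFormula
import HarnessLib

/-!
# The zero sum of `ζ₁_K` over the zeros INSIDE the classical zero-free region, against the
# Thorner–Zaman weight, from an abstract log-free density bound

Topic `Summits/QuantumAdvantage/QuantumAdvantage/Theorems`, helper for the stub
`stub_lowerPIT_of_density` (T5 of line `subgroup-orthogonality-escape`, crux `DegreeOnePrimesEscape`,
stmt-QuantumAdvantage-11543); cell B2b-1 (linnik-cubic), PART A.  HONEST FRAMING: the value of this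
file is a THEOREM (kernel-checked lemmas) — not summit progress.

This is the `ζ₁_K = (s − 1)ζ_K` twin of `…PerCharacterDeficitZeroSum.lean` (one class group
`L`-function, non-real zeros).  For the LOWER prime ideal theorem the real zeros cannot be dropped by
sign; instead the zeros are split by the classical zero-free inequality
`β ≤ 1 − c/(𝓠 + log(|γ| + 4))`: those satisfying it are summed here, by density, and the at most one
zero violating it (Landau–Page) is treated separately by the consumer.  For a number field `K` of
degree `n > 1`, the weight `g = tzTest (log x) ε` (`x^{−ν} ≤ ε ≤ 1`) and its Laplace transform `F`:

  `Σ_{ρ ∈ u, β ≤ 1 − c/(a log Q + log(|γ|+4))} m(ρ) ‖F(−ρ)‖ ≤ A₀ x (e^{−cL/(4a log Q)} + e^{−√(cL/4)}) + A₀ x^{1−ν}`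

(`zeroSum_dedekindZeta₁_zfr_le`), `Q = condQn K`, `L = log x ≥ a₀ log Q`, GIVEN the log-free density
bound `Σ_{|γ| ≤ T, β ≥ α} m ≤ D e^{b(a log Q + log(T + 4))(1 − α)}` for the zeros of `ζ₁_K` — NO zero-free
region is assumed (the summed zeros carry it by definition).  Ingredients (all in tree):
`EntireEF.sum_zeroTerm_le` (arbitrary excluded set), `LinnikZeroSum.sum_rpow_div_le_of_density_zfr`,
`sum_mult_le_of_window`, `junk_le`, `window_bound_dedekindZeta₁`.
-/

noncomputable section

open Complex Real MeasureTheory Set Filter Topology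
open scoped NumberField nonZeroDivisors
open Literature.NumberTheory.LFunctions Literature.NumberTheory.LFunctions.NumberField
  Literature.NumberTheory.LFunctions.EntireEF Literature.NumberTheory.LFunctions.TZWeight

namespace Summit.QuantumAdvantage.QuantumAdvantage.Theorems.DegreeOnePrimesEscape

/-! ### The finite part, one entire function, zeros inside the zero-free region -/

/-- **The finite part of the zero sum over the zeros of one entire function inside the region
`β ≤ 1 − c_Z/(𝓠 + log(|γ| + 4))`** (abstract Thorner–Zaman Lemmas 4.5–4.6): for `f` entire, non-zero
at `c₀`, with the log-free density bound `Σ_{|γ| ≤ T, α ≤ β} m ≤ D₀ e^{b(𝓠 + log(T + 4))(1−α)}` and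
`e^{b(𝓠 + log(2T₁+4))} ≤ √x`:
`Σ_{|γ| ≤ T₁, β ≤ 1 − c_Z/(𝓠+log(|γ|+4)), β ≥ 1/4} m x^{β−1}/max(1,|γ|) ≤ 64 D₀ (e^{−c_Z L/(4𝓠)} + e^{−√(c_Z L/4)})`.
No zero-free region is assumed: the summed zeros satisfy it by the filter. -/
theorem finitePart_zfr_le {f : ℂ → ℂ} (hf : Differentiable ℂ f) {c₀ : ℂ} (hc₀ : f c₀ ≠ 0)
    {x 𝓠 c_Z b D₀ T₁ : ℝ} (hx : 1 < x) (h𝓠 : 1 ≤ 𝓠) (hcZ : 0 < c_Z) (hb : 0 ≤ b) (hD₀ : 0 ≤ D₀)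
    (hT₁ : 1 ≤ T₁)
    (hdens : ∀ T : ℝ, 1 ≤ T → ∀ u : Finset ℂ,
      (∀ ρ ∈ u, f ρ = 0 ∧ 1 / 4 ≤ ρ.re ∧ ρ.re < 1 ∧ |ρ.im| ≤ T) → ∀ α : ℝ, α ≤ 1 →
        ∑ ρ ∈ u with α ≤ ρ.re, (analyticOrderNatAt f ρ : ℝ) ≤
          D₀ * Real.exp (b * (𝓠 + Real.log (T + 4))) ^ (1 - α))
    (hrange : Real.exp (b * (𝓠 + Real.log (2 * T₁ + 4))) ≤ x ^ ((1 : ℝ) / 2)) :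
    ∑ ρ ∈ (finite_nontrivialZeros_inter hf hc₀ T₁).toFinset with
        (ρ.re ≤ 1 - c_Z / (𝓠 + Real.log (|ρ.im| + 4)) ∧ 1 / 4 ≤ ρ.re),
        (analyticOrderNatAt f ρ : ℝ) * x ^ (ρ.re - 1) / max 1 |ρ.im| ≤
      64 * D₀ * (Real.exp (-(c_Z * Real.log x / (4 * 𝓠))) +
        Real.exp (-Real.sqrt (c_Z * Real.log x / 4))) := by
  classical
  set s := (finite_nontrivialZeros_inter hf hc₀ T₁).toFinset.filter
    (fun ρ ↦ ρ.re ≤ 1 - c_Z / (𝓠 + Real.log (|ρ.im| + 4)) ∧ 1 / 4 ≤ ρ.re) with hs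
  have hmem : ∀ ρ ∈ s, (f ρ = 0 ∧ 0 < ρ.re ∧ ρ.re < 1) ∧ |ρ.im| ≤ T₁ ∧
      ρ.re ≤ 1 - c_Z / (𝓠 + Real.log (|ρ.im| + 4)) ∧ 1 / 4 ≤ ρ.re := by
    intro ρ hρ
    rw [hs, Finset.mem_filter, Set.Finite.mem_toFinset] at hρ
    exact ⟨hρ.1.1, hρ.1.2, hρ.2.1, hρ.2.2⟩
  refine LinnikZeroSum.sum_rpow_div_le_of_density_zfr s (fun ρ ↦ ρ.re) (fun ρ ↦ ρ.im)
    (fun ρ ↦ (analyticOrderNatAt f ρ : ℝ)) hx h𝓠 hcZ hb hD₀ hT₁ (fun _ _ ↦ Nat.cast_nonneg _)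
    (fun ρ hρ ↦ (hmem ρ hρ).2.1) (fun ρ hρ ↦ (hmem ρ hρ).2.2.1) (fun T α hT hα ↦ ?_) hrange
  have h := hdens T hT (s.filter (fun ρ ↦ |ρ.im| ≤ T)) (fun ρ hρ ↦ ?_) α hα
  · rw [Finset.filter_filter] at h
    exact h
  · rw [Finset.mem_filter] at hρ
    obtain ⟨⟨h0, -, h2⟩, -, -, h14⟩ := hmem ρ hρ.1
    exact ⟨h0, h14, h2, hρ.2⟩

/-! ### One function against the weight: the zeros inside the zero-free region -/

/-- **The zero terms over the zeros of one function inside the region `β ≤ 1 − c_Z/(𝓠 + log(|γ|+4))`,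
against the TZ weight** (`EntireEF.sum_zeroTerm_le` with the zeros violating the inequality excluded):
for a finite set `u` of non-trivial zeros, `Σ_{ρ ∈ u, β ≤ 1 − c_Z/(𝓠+log(|γ|+4))} m ‖F(−ρ)‖ ≤ e^ε x (8M S + J)` with
`S = Σ_{|γ| ≤ T₁, β ≤ 1 − c_Z/(𝓠+log(|γ|+4)), β ≥ 1/4} m x^{β−1}/max(1,|γ|)` and the junk
`J = (L + ε + 8M) x^{−3/4} Σ_{|γ| ≤ T₁} m + (2M/ε) T₁^{−1/2} W (c₁A + c₂)`. -/
theorem sum_zfr_zeroTerm_le {f : ℂ → ℂ} (hf : Differentiable ℂ f) {c₀ : ℂ} (hc₀ : f c₀ ≠ 0)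
    {W A : ℝ} (hW : 0 ≤ W) (hA : 0 ≤ A)
    (hwin : ∀ (τ : ℝ) (P : Finset ℂ), (∀ ρ ∈ P, f ρ = 0 ∧ 0 < ρ.re ∧ ρ.re < 1 ∧ |ρ.im - τ| ≤ 1 / 2) →
      ∑ ρ ∈ P, (analyticOrderNatAt f ρ : ℝ) ≤ W * (A + Real.log (|τ| + 4)))
    {M : ℝ} (hM : ∀ y : ℝ, |iteratedDeriv 1 Real.smoothTransition y| ≤ M ∧
      |iteratedDeriv 2 Real.smoothTransition y| ≤ M)
    {x ε : ℝ} (hx : 1 < x) (hε : 0 < ε) (hεL : ε < Real.log x / 2) {T₁ : ℝ} (hT₁ : 1 ≤ T₁)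
    (c_Z 𝓠 : ℝ) (u : Finset ℂ) (hu : ∀ ρ ∈ u, f ρ = 0 ∧ 0 < ρ.re ∧ ρ.re < 1) :
    ∑ ρ ∈ u with ρ.re ≤ 1 - c_Z / (𝓠 + Real.log (|ρ.im| + 4)),
        (analyticOrderNatAt f ρ : ℝ) * ‖fordLaplace (tzTest (Real.log x) ε) (-ρ)‖ ≤
      Real.exp ε * x *
        (8 * M * ∑ ρ ∈ (finite_nontrivialZeros_inter hf hc₀ T₁).toFinset with
            (ρ.re ≤ 1 - c_Z / (𝓠 + Real.log (|ρ.im| + 4)) ∧ 1 / 4 ≤ ρ.re),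
            (analyticOrderNatAt f ρ : ℝ) * x ^ (ρ.re - 1) / max 1 |ρ.im| +
          ((Real.log x + ε + 8 * M) * x ^ (-(3 : ℝ) / 4) *
              ∑ ρ ∈ (finite_nontrivialZeros_inter hf hc₀ T₁).toFinset, (analyticOrderNatAt f ρ : ℝ) +
            (2 * M / ε) * T₁ ^ (-((1 : ℝ) / 2)) * (W * (tailConst₁ * A + tailConst₂)))) := by
  classical
  have hx0 : 0 < x := by linarith
  set Lx : ℝ := Real.log x with hLx
  have hL0 : 0 < Lx := Real.log_pos hx
  have hexpL : Real.exp Lx = x := by rw [hLx, Real.exp_log hx0]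
  have hdp : DecidablePred (· ∈ nontrivialZeros f) := fun _ ↦ Classical.propDecidable _
  set Fin := (finite_nontrivialZeros_inter hf hc₀ T₁).toFinset with hFin
  set good : ℂ → Prop := fun ρ ↦ ρ.re ≤ 1 - c_Z / (𝓠 + Real.log (|ρ.im| + 4)) with hgood
  set Exc : Finset ℂ := (Fin ∪ u).filter (fun ρ ↦ ¬ good ρ) with hExc
  set u' : Finset (nontrivialZeros f) :=
    ((u.filter (fun ρ ↦ good ρ)).subtype (· ∈ nontrivialZeros f)) with hu'
  have key := sum_zeroTerm_le hf hc₀ hW hA hwin hM hL0 hε hεL hT₁ Exc u'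
  -- the left side
  have h1 : u'.filter (fun ρ' : nontrivialZeros f ↦ (ρ' : ℂ) ∉ Exc) = u' := by
    refine Finset.filter_true_of_mem fun ρ' hρ' ↦ ?_
    rw [hu', Finset.mem_subtype, Finset.mem_filter] at hρ'
    rw [hExc, Finset.mem_filter, not_and_or, not_not]
    exact Or.inr hρ'.2
  rw [h1] at key
  have hLHS : ∑ ρ' ∈ u', (analyticOrderNatAt f (ρ' : ℂ) : ℝ) * ‖fordLaplace (tzTest Lx ε) (-(ρ' : ℂ))‖ =
      ∑ ρ ∈ u with good ρ, (analyticOrderNatAt f ρ : ℝ) * ‖fordLaplace (tzTest Lx ε) (-ρ)‖ := by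
    rw [hu', Finset.sum_subtype_of_mem
      (fun ρ : ℂ ↦ (analyticOrderNatAt f ρ : ℝ) * ‖fordLaplace (tzTest Lx ε) (-ρ)‖)]
    intro ρ hρ
    rw [Finset.mem_filter] at hρ
    exact hu ρ hρ.1
  rw [hLHS] at key
  refine key.trans ?_
  rw [hexpL]
  refine mul_le_mul_of_nonneg_left ?_ (by positivity)
  rw [add_assoc]
  refine add_le_add ?_ le_rfl
  -- the finite part: the filter `ρ ∉ Exc` is `good ρ` on `Fin`
  have hM0 : 0 ≤ M := le_trans (abs_nonneg _) (hM 0).1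
  refine mul_le_mul_of_nonneg_left (le_of_eq ?_) (by positivity)
  refine Finset.sum_congr (Finset.filter_congr fun ρ hρ ↦ ?_) fun _ _ ↦ rfl
  rw [hExc, Finset.mem_filter, not_and_or, not_not]
  constructor
  · rintro ⟨h | h, h14⟩
    · exact absurd (Finset.mem_union_left _ hρ) h
    · exact ⟨h, h14⟩
  · rintro ⟨h, h14⟩; exact ⟨Or.inr h, h14⟩

/-! ### `ζ₁_K`: the zeros inside the zero-free region -/

set_option maxHeartbeats 800000 in
/-- **The zero sum of `ζ₁_K` over its zeros inside `β ≤ 1 − c/(a log Q + log(|γ| + 4))`, from density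
alone** (general degree `n > 1`; the analogue of Thorner–Zaman 2019 §4.3 for `ζ_K` with the at most one
Landau–Page zero excluded by the filter). With `Q = condQn K`, `L = log x`: there are `ν ∈ (0, 1/64]`,
`a₀ ≥ 1`, `A₀ > 0` depending only on `n, b, D, a` such that for every `c > 0`, every `K` of degree `n`
whose zeros of `ζ₁_K` obey the density bound `Σ_{|γ| ≤ T, β ≥ α} m ≤ D e^{b(a log Q + log(T+4))(1−α)}`
(`T ≥ 1`, `α ≤ 1`), every `x ≥ Q^{a₀}`, `x^{−ν} ≤ ε ≤ 1` and every finite set `u` of non-trivial zeros: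
`Σ_{ρ ∈ u, β ≤ 1 − c/(a log Q + log(|γ|+4))} m(ρ)‖F(−ρ)‖ ≤ A₀ x (e^{−cL/(4a log Q)} + e^{−√(cL/4)}) + A₀ x^{1−ν}`. -/
theorem zeroSum_dedekindZeta₁_zfr_le (n : ℕ) (hn : 1 < n) {b D a : ℝ} (hb : 0 < b) (hD : 0 < D) (ha : 1 ≤ a) :
    ∃ ν a₀ A₀ : ℝ, 0 < ν ∧ ν ≤ 1 / 64 ∧ 1 ≤ a₀ ∧ 0 < A₀ ∧
    ∀ (c : ℝ), 0 < c → ∀ (K : Type) [Field K] [NumberField K], Module.finrank ℚ K = n →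
      (∀ T : ℝ, 1 ≤ T → ∀ u : Finset ℂ,
        (∀ ρ ∈ u, dedekindZeta₁ K ρ = 0 ∧ 1 / 4 ≤ ρ.re ∧ ρ.re < 1 ∧ |ρ.im| ≤ T) →
        ∀ α : ℝ, α ≤ 1 →
          ∑ ρ ∈ u with α ≤ ρ.re, (analyticOrderNatAt (dedekindZeta₁ K) ρ : ℝ) ≤
            D * Real.exp (b * (a * Real.log (ThornerZaman.condQn K) + Real.log (T + 4))) ^ (1 - α)) →
      ∀ x : ℝ, ThornerZaman.condQn K ^ a₀ ≤ x → ∀ ε : ℝ, x ^ (-ν) ≤ ε → ε ≤ 1 →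
      ∀ u : Finset ℂ, (∀ ρ ∈ u, dedekindZeta₁ K ρ = 0 ∧ 0 < ρ.re ∧ ρ.re < 1) →
        ∑ ρ ∈ u with ρ.re ≤ 1 - c / (a * Real.log (ThornerZaman.condQn K) + Real.log (|ρ.im| + 4)),
            (analyticOrderNatAt (dedekindZeta₁ K) ρ : ℝ) * ‖fordLaplace (tzTest (Real.log x) ε) (-ρ)‖ ≤
          A₀ * x * (Real.exp (-(c * Real.log x / (4 * a * Real.log (ThornerZaman.condQn K)))) +
              Real.exp (-Real.sqrt (c * Real.log x / 4))) + A₀ * x ^ (1 - ν) := by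
  classical
  obtain ⟨M, hM1, hM⟩ := TZWeight.exists_smoothTransition_deriv_bound
  obtain ⟨hc₁16, hc₂0⟩ := tailConst_nonneg
  set β₀ : ℝ := max b 1 with hβ₀
  have hβ₀1 : 1 ≤ β₀ := le_max_right _ _
  have hbβ₀ : b ≤ β₀ := le_max_left _ _
  set ν : ℝ := 1 / (64 * β₀) with hν
  have hν0 : 0 < ν := by positivity
  have hν64 : ν ≤ 1 / 64 := by
    rw [hν]; exact one_div_le_one_div_of_le (by norm_num) (by nlinarith)
  set a₀ : ℝ := 400 * a * β₀ with ha₀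
  set W₀ : ℝ := 512 * ((n : ℝ) + 1) with hW₀
  have hW₀0 : 0 ≤ W₀ := by positivity
  set A₁ : ℝ := 50 * W₀ * (1 / ν + 1 + 8 * M) + 2 * M * W₀ * (4 * tailConst₁ + tailConst₂) with hA₁
  have hA₁0 : 0 ≤ A₁ := by
    have : 0 ≤ M := by linarith
    have : 0 ≤ tailConst₁ := by linarith
    positivity
  set A₀ : ℝ := Real.exp 1 * (512 * M * D + A₁) with hA₀
  refine ⟨ν, a₀, A₀, hν0, hν64, by rw [ha₀]; nlinarith, by positivity,
    fun c hc K _ _ hKn hdens x hx ε hεν hε1 u hu ↦ ?_⟩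
  -- sizes
  have hK : 1 < Module.finrank ℚ K := by rw [hKn]; exact hn
  set Q : ℝ := ThornerZaman.condQn K with hQ
  have hQ12 : (12 : ℝ) ≤ Q := ThornerZaman.twelve_le_condQn (K := K) hK
  have hQ1 : (1 : ℝ) < Q := by linarith
  have hlog12 : (2 : ℝ) ≤ Real.log 12 := by
    rw [Real.le_log_iff_exp_le (by norm_num)]
    have := Real.exp_one_lt_d9
    have h : Real.exp 2 = Real.exp 1 * Real.exp 1 := by rw [← Real.exp_add]; norm_num
    rw [h]; nlinarith [Real.exp_pos (1:ℝ)]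
  have hlogQ : 2 ≤ Real.log Q := hlog12.trans (Real.log_le_log (by norm_num) hQ12)
  have ha₀1 : (1 : ℝ) ≤ a₀ := by rw [ha₀]; nlinarith
  have hxQ : Q ≤ x := by
    have : Q ^ (1 : ℝ) ≤ Q ^ a₀ := Real.rpow_le_rpow_of_exponent_le hQ1.le ha₀1
    rw [Real.rpow_one] at this; linarith
  have hx1 : 1 < x := by linarith
  have hx0 : 0 < x := by linarith
  set Lx : ℝ := Real.log x with hLx
  have hLQ : a₀ * Real.log Q ≤ Lx := by
    have := Real.log_le_log (by positivity) hx
    rwa [Real.log_rpow (by linarith)] at this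
  have hL800 : 800 * β₀ ≤ Lx := by nlinarith
  have hL0 : 0 < Lx := by linarith
  have hε0 : 0 < ε := lt_of_lt_of_le (Real.rpow_pos_of_pos hx0 _) hεν
  have hεL : ε < Lx / 2 := by linarith
  set T₁ : ℝ := x ^ (6 * ν) with hT₁
  have hT₁1 : 1 ≤ T₁ := Real.one_le_rpow hx1.le (by positivity)
  -- the window data (`n` general)
  set A : ℝ := Real.log ((NumberField.discr K).natAbs : ℝ) + 3 * n with hAdef
  have hAnn : 0 ≤ A := by have := Real.log_natCast_nonneg (NumberField.discr K).natAbs; positivity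
  set L0 := dedekindZeta₁ K with hL0def
  have hdf : Differentiable ℂ L0 := dedekindZeta₁_differentiable K
  have hc₀ : L0 (2 + ((0 : ℝ) : ℂ) * I) ≠ 0 := dedekindZeta₁_two_add_ne_zero 0
  have hwin : ∀ (τ : ℝ) (P : Finset ℂ), (∀ ρ ∈ P, L0 ρ = 0 ∧ 0 < ρ.re ∧ ρ.re < 1 ∧ |ρ.im - τ| ≤ 1 / 2) →
      ∑ ρ ∈ P, (analyticOrderNatAt L0 ρ : ℝ) ≤ W₀ * (A + Real.log (|τ| + 4)) := by
    intro τ P hP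
    have := window_bound_dedekindZeta₁ (K := K) τ P hP
    rw [hKn] at this
    convert this using 2
  -- (A) the per-function estimate, `𝓠 = a log Q`
  set 𝓠 : ℝ := a * Real.log Q with h𝓠
  have h𝓠1 : 1 ≤ 𝓠 := by rw [h𝓠]; nlinarith
  set S : ℝ := ∑ ρ ∈ (finite_nontrivialZeros_inter hdf hc₀ T₁).toFinset with
      (ρ.re ≤ 1 - c / (𝓠 + Real.log (|ρ.im| + 4)) ∧ 1 / 4 ≤ ρ.re),
    (analyticOrderNatAt L0 ρ : ℝ) * x ^ (ρ.re - 1) / max 1 |ρ.im| with hS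
  set J : ℝ := (Lx + ε + 8 * M) * x ^ (-(3 : ℝ) / 4) * ((2 * T₁ + 3) * (W₀ * (A + Real.log (T₁ + 5)))) +
    (2 * M / ε) * T₁ ^ (-((1 : ℝ) / 2)) * (W₀ * (tailConst₁ * A + tailConst₂)) with hJ
  have hper : ∑ ρ ∈ u with ρ.re ≤ 1 - c / (𝓠 + Real.log (|ρ.im| + 4)),
      (analyticOrderNatAt L0 ρ : ℝ) * ‖fordLaplace (tzTest Lx ε) (-ρ)‖ ≤
      Real.exp ε * x * (8 * M * S + J) := by
    have key := sum_zfr_zeroTerm_le hdf hc₀ hW₀0 hAnn hwin hM hx1 hε0 hεL hT₁1 c 𝓠 u hu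
    refine key.trans ?_
    refine mul_le_mul_of_nonneg_left (add_le_add le_rfl ?_) (by positivity)
    rw [hJ]
    refine add_le_add (mul_le_mul_of_nonneg_left ?_ ?_) le_rfl
    · refine sum_mult_le_of_window hW₀0 hAnn hwin (by linarith) _ fun ρ hρ ↦ ?_
      rw [Set.Finite.mem_toFinset] at hρ
      exact ⟨hρ.1.1, hρ.1.2.1, hρ.1.2.2, hρ.2⟩
    · have : 0 ≤ M := by linarith
      positivity
  -- (C) the finite part by density, the zero-free inequality being the filter
  have hrange : Real.exp (b * (𝓠 + Real.log (2 * T₁ + 4))) ≤ x ^ ((1 : ℝ) / 2) := by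
    rw [show x ^ ((1 : ℝ) / 2) = Real.exp (Lx / 2) by rw [hLx, Real.rpow_def_of_pos hx0]; ring_nf]
    refine Real.exp_le_exp.2 ?_
    have hT6 : Real.log (2 * T₁ + 4) ≤ 2 + 6 * ν * Lx := by
      have h1 : Real.log (2 * T₁ + 4) ≤ Real.log (6 * T₁) :=
        Real.log_le_log (by linarith only [hT₁1]) (by linarith only [hT₁1])
      rw [Real.log_mul (by norm_num) (by linarith only [hT₁1]), hT₁, Real.log_rpow hx0, ← hLx] at h1
      have h3 : Real.log 6 ≤ 2 := by
        rw [Real.log_le_iff_le_exp (by norm_num)]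
        have := Real.exp_one_gt_d9
        have h : Real.exp 2 = Real.exp 1 * Real.exp 1 := by rw [← Real.exp_add]; norm_num
        rw [h]; nlinarith only [this]
      linarith only [h1, h3]
    have hbν : b * (6 * ν * Lx) ≤ 6 / 64 * Lx := by
      have hbν' : b * ν ≤ 1 / 64 := by
        rw [hν]; rw [show b * (1 / (64 * β₀)) = b / β₀ / 64 by ring]
        have : b / β₀ ≤ 1 := (div_le_one (by positivity)).2 hbβ₀
        linarith
      have : b * (6 * ν * Lx) = 6 * (b * ν) * Lx := by ring
      rw [this]
      have := mul_le_mul_of_nonneg_right hbν' hL0.le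
      linarith only [this]
    have hb2 : b * 2 ≤ Lx / 400 := by linarith only [hbβ₀, hL800]
    have hbQ : b * 𝓠 ≤ Lx / 400 := by
      have h0Q : 0 ≤ a * Real.log Q := by nlinarith only [hlogQ, ha]
      have h1 : b * (a * Real.log Q) ≤ β₀ * (a * Real.log Q) := mul_le_mul_of_nonneg_right hbβ₀ h0Q
      have h2' : β₀ * (a * Real.log Q) = (a₀ * Real.log Q) / 400 := by rw [ha₀]; ring
      rw [h2'] at h1
      have h3 : (a₀ * Real.log Q) / 400 ≤ Lx / 400 := by linarith only [hLQ]
      rw [h𝓠]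
      linarith only [h1, h3]
    have h4 : b * Real.log (2 * T₁ + 4) ≤ b * 2 + b * (6 * ν * Lx) := by
      have := mul_le_mul_of_nonneg_left hT6 hb.le; linarith only [this]
    have h5 : b * (𝓠 + Real.log (2 * T₁ + 4)) = b * 𝓠 + b * Real.log (2 * T₁ + 4) := by ring
    rw [h5]
    linarith only [hbQ, h4, hbν, hb2, hL0]
  have hfin : S ≤ 64 * D * (Real.exp (-(c * Lx / (4 * 𝓠))) + Real.exp (-Real.sqrt (c * Lx / 4))) := by
    rw [hS]
    exact finitePart_zfr_le hdf hc₀ hx1 h𝓠1 hc hb.le hD.le hT₁1 hdens hrange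
  -- (D) the junk (`h = 1`)
  have hh : (1 : ℝ) ≤ Q ^ 2 := one_le_pow₀ hQ1.le
  have hAQ : A ≤ 4 * Q := by
    have := windowConst_le_condQn K
    rw [hKn] at this
    rw [hAdef]; linarith
  have hQ3 : Q ^ 3 ≤ x ^ ν := by
    have h1 : Q ^ 3 = Real.exp (3 * Real.log Q) := by
      rw [← Real.rpow_natCast, Real.rpow_def_of_pos (by linarith)]; norm_num; ring_nf
    rw [h1, Real.rpow_def_of_pos hx0, ← hLx]
    refine Real.exp_le_exp.2 ?_
    have haν : a₀ * ν = 400 * a / 64 := by rw [ha₀, hν]; field_simp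
    have h2' : ν * (a₀ * Real.log Q) ≤ ν * Lx := mul_le_mul_of_nonneg_left hLQ hν0.le
    have h3 : ν * (a₀ * Real.log Q) = 400 * a / 64 * Real.log Q := by rw [← haν]; ring
    have h0Q : 0 ≤ Real.log Q := by linarith only [hlogQ]
    nlinarith only [h2', h3, h0Q, ha]
  have hjunk : (1 : ℝ) * J ≤ A₁ * x ^ (-ν) := by
    rw [hJ, hA₁, hT₁, hLx]
    exact junk_le hν0 hν64 hQ12 hQ3 hx1 zero_le_one hh hAnn hAQ hM1 hW₀0
      (by linarith) hc₂0 hεν hε1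
  rw [one_mul] at hjunk
  -- (E) assemble
  have hεe : Real.exp ε ≤ Real.exp 1 := Real.exp_le_exp.2 hε1
  set E : ℝ := Real.exp (-(c * Lx / (4 * 𝓠))) + Real.exp (-Real.sqrt (c * Lx / 4)) with hE
  have hE0 : 0 ≤ E := by positivity
  have hM0 : 0 ≤ M := by linarith
  have hxν : x * x ^ (-ν) = x ^ (1 - ν) := by
    rw [sub_eq_add_neg, Real.rpow_add hx0, Real.rpow_one]
  have hE' : Real.exp (-(c * Real.log x / (4 * a * Real.log (ThornerZaman.condQn K)))) +
      Real.exp (-Real.sqrt (c * Real.log x / 4)) = E := by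
    rw [hE, h𝓠, hQ, hLx]; ring_nf
  have hfilter : ∑ ρ ∈ u with ρ.re ≤ 1 - c / (a * Real.log (ThornerZaman.condQn K) + Real.log (|ρ.im| + 4)),
        (analyticOrderNatAt (dedekindZeta₁ K) ρ : ℝ) * ‖fordLaplace (tzTest (Real.log x) ε) (-ρ)‖ =
      ∑ ρ ∈ u with ρ.re ≤ 1 - c / (𝓠 + Real.log (|ρ.im| + 4)),
        (analyticOrderNatAt L0 ρ : ℝ) * ‖fordLaplace (tzTest Lx ε) (-ρ)‖ := by
    rw [h𝓠, hQ, hLx]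
  rw [hE', hfilter]
  calc ∑ ρ ∈ u with ρ.re ≤ 1 - c / (𝓠 + Real.log (|ρ.im| + 4)),
        (analyticOrderNatAt L0 ρ : ℝ) * ‖fordLaplace (tzTest Lx ε) (-ρ)‖
      ≤ Real.exp ε * x * (8 * M * S + J) := hper
    _ ≤ Real.exp 1 * x * (8 * M * (64 * D * E) + A₁ * x ^ (-ν)) := by
        have hin : 0 ≤ 8 * M * S + J := by
          have hS0 : 0 ≤ S := by
            rw [hS]
            exact Finset.sum_nonneg fun ρ _ ↦ div_nonneg (mul_nonneg (Nat.cast_nonneg _)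
              (Real.rpow_nonneg hx0.le _)) (by positivity)
          have hJ0 : 0 ≤ J := by
            rw [hJ]
            have : 0 ≤ Real.log (T₁ + 5) := Real.log_nonneg (by linarith)
            have ht1 : 0 ≤ tailConst₁ := by linarith
            have : 0 ≤ tailConst₁ * A + tailConst₂ := by positivity
            positivity
          positivity
        exact mul_le_mul (mul_le_mul_of_nonneg_right hεe hx0.le)
          (add_le_add (mul_le_mul_of_nonneg_left hfin (by positivity)) hjunk) hin (by positivity)
    _ = Real.exp 1 * (512 * M * D) * x * E + Real.exp 1 * A₁ * x ^ (1 - ν) := by rw [← hxν]; ring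
    _ ≤ A₀ * x * E + A₀ * x ^ (1 - ν) := by
        refine add_le_add ?_ ?_
        · rw [hA₀]
          have h0 : 0 ≤ Real.exp 1 * A₁ * (x * E) := by positivity
          nlinarith only [h0]
        · refine mul_le_mul_of_nonneg_right ?_ (Real.rpow_nonneg hx0.le _)
          rw [hA₀]
          have : 0 ≤ Real.exp 1 * (512 * M * D) := by positivity
          nlinarith only [this]

end Summit.QuantumAdvantage.QuantumAdvantage.Theorems.DegreeOnePrimesEscape

end
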